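import Summits.CriticalPhenomena.PercolationContinuityZ3.Theorems.FK.Transplant.QComparisonClusterCount
import HarnessLib

/-!
# Strict comparison in `q`, 2/5: sums over configurations — finite energy for a set of closed edges, FKG for
# increasing functions and for decreasing cylinders, the zero covariance of an edge inside the wired set

Registered R71 (cell INBOX l.5302, 2026-08-23); registry row T1m; label T1m-B (coordinator fk-4 g139; adopted by the lead, L45 l.5303 = typer read NO OBJECTION at the statement layer); placement R71 (δ): all seven files of this package live under `Theorems/FK/Transplant/` (own-chain imports re-pointed; statements untouched).
builds on p205010 (kernel theorem, internal audit signed; external expert review pending). Support file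
(`--supports stmt-CriticalPhenomena-4575`, helper) typed by the FRONTIER TRANSPLANT seat `prim-bschramm-fkt-p2`
(`fk-continuity/transplant/`). No definitions, no named facts, no sorries; standard axioms.

HONEST FRAMING (page 1, cell rule). Everything in this file is UNCONDITIONAL finite-graph random-cluster theory
(`q ≥ 1`). It does NOT touch the transplant's theorem of record `ufsc0_of_freeBoundaryHypothesis_r3` (p248245,
« 2 / 0 ☑ »), which stays CONDITIONAL on FH AND TP_FK (open at the same `p` for `q > 1`; ⇔ GRC Conj. (5.103) via K1;
barrier note `Literature.Barriers.CriticalPhenomena.SamePFreeBoundaryCriteria`); not a binder discharge, not a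
re-cut, not `_r4`; `n_open = 2`, BINDER-OWNERS, FO-19 NO-GO unchanged. Purpose of the package
(`QComparisonClusterCount` → `QComparisonSums` → `QComparisonCovariance` → `QComparisonSegment` →
`CriticalPointStrictMono`): the second half of Grimmett 2006 Thm. (5.10) — `q ↦ p_c(q)` is STRICTLY increasing on
`[1, ∞)` for `d ≥ 2` — which `Theorems/FK/CriticalPointBounds.lean` records as "not in this file … needs Thm. (3.24),
not in the tree". The route is NOT the printed one: Grimmett proves Prop. (3.28) by a pair of coupled Markov chains
([151] = Grimmett 1995); here the left inequality of (3.29) gets a STATIC proof (FKG for the increasing function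
`N_W - 2k^B`, FKG on the graph with one edge removed, one-edge finite energy, independence of the edges inside the
wired set) with the explicit constant `α(p, q) = p(1-p)^Δ/(2Δ)`, and Thm. (3.24)'s contour function `γ` is replaced
by explicit admissible segments.

## Contents (namespace `Summit.CriticalPhenomena.PercolationContinuityZ3.Theorems.FK`)

§3 `sum_powerset_split_edge`, `one_sub_mul_sum_powerset_le` / **`pow_mul_sum_powerset_le`**
(`(1-p)^{|F|} Σ_{ω ⊆ S} w ≤ Σ_{ω ⊆ S∖F} w`), `rcWeight_lattice_condition_subset`, `sum_ite_subset_mul`,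
**`fkg_sum_powerset`** (FKG for increasing functions under the weights of the edge sets of `S ⊆ E(G)`, Mathlib's `fkg`),
`sum_powerset_ite_disjoint`, **`sum_mul_sum_sdiff_le`** (`E(X | all edges of T closed) ≤ E X`),
**`sum_mul_eq_of_clusterCount_insert`** (an edge whose opening never changes `k^B` is independent `p`-noise),
`sum_powerset_erase_eq`, `isolated_iff_disjoint_incidenceFinset`, `natCard_isolated_eq_sum`.

## References

* G. Grimmett, *The Random-Cluster Model*, Springer 2006: §3.4 Thm. (3.21)–(3.24), Prop. (3.28) eq. (3.29) and its
  proof (3.36)–(3.39), proof of Thm. (3.24) (3.40)–(3.41), pp. 47–52; Thm. (3.1) eq. (3.3); Thm. 3.8 (FKG); §5.1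
  Thm. (5.5), Thm. (5.10) and its proof (5.14)–(5.15), pp. 99–101. [Grimmett2006]
* G. R. Grimmett, *Comparison and disjoint-occurrence inequalities for random-cluster models*, J. Statist. Phys. 78
  (1995) 1311–1324 (Grimmett's [151]). [Grimmett1995]
-/

noncomputable section

open scoped Classical
open MeasureTheory Finset SimpleGraph

namespace Summit.CriticalPhenomena.PercolationContinuityZ3.Theorems

namespace FK

open Literature.Probability.LatticeModels Literature.Probability.Percolation

/-! ### 3. Sums over configurations: finite energy, FKG, and edges inside the wired set -/

section Sums

variable {V : Type*} [Fintype V] [DecidableEq V] (G : SimpleGraph V) [DecidableRel G.Adj]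

omit [Fintype V] in
/-- Splitting a sum over the edge sets of `S` according to one edge `e ∈ S`: `ω ↔ ω ∪ {e}`. [folklore] -/
theorem sum_powerset_split_edge (S : Finset (Sym2 V)) {e : Sym2 V} (he : e ∈ S) (F : Finset (Sym2 V) → ℝ) :
    ∑ ω ∈ S.powerset, F ω =
      ∑ ω ∈ (S.erase e).powerset, F ω + ∑ ω ∈ (S.erase e).powerset, F (insert e ω) := by
  conv_lhs => rw [← insert_erase he]
  exact sum_powerset_insert (notMem_erase e S) F

/-- **Finite energy, one edge**: closing one further edge costs at most a factor `1 - p`: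
`(1 - p) Σ_{ω ⊆ S} w(ω) ≤ Σ_{ω ⊆ S ∖ {f}} w(ω)` (`q ≥ 1`). [cite: Grimmett2006, Thm. (3.1) eq. (3.3)–(3.4)] -/
theorem one_sub_mul_sum_powerset_le {p q : ℝ} (hp : p ∈ Set.Icc (0 : ℝ) 1) (hq : 1 ≤ q) (B : Set V)
    {S : Finset (Sym2 V)} (hS : S ⊆ G.edgeFinset) {f : Sym2 V} (hf : f ∈ S) :
    (1 - p) * ∑ ω ∈ S.powerset, rcWeight G p q B ω ≤ ∑ ω ∈ (S.erase f).powerset, rcWeight G p q B ω := by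
  rw [sum_powerset_split_edge S hf, mul_add, mul_sum, mul_sum]
  have h1 : ∀ ω ∈ (S.erase f).powerset,
      (1 - p) * rcWeight G p q B (insert f ω) ≤ p * rcWeight G p q B ω := by
    intro ω hω
    rw [mul_comm]
    exact rcWeight_insert_mul_le G hp hq B (hS hf) fun h => notMem_erase f S (mem_powerset.1 hω h)
  calc ∑ ω ∈ (S.erase f).powerset, (1 - p) * rcWeight G p q B ω +
        ∑ ω ∈ (S.erase f).powerset, (1 - p) * rcWeight G p q B (insert f ω)
      ≤ ∑ ω ∈ (S.erase f).powerset, (1 - p) * rcWeight G p q B ω +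
          ∑ ω ∈ (S.erase f).powerset, p * rcWeight G p q B ω :=
        add_le_add le_rfl (sum_le_sum h1)
    _ = ∑ ω ∈ (S.erase f).powerset, rcWeight G p q B ω := by
        rw [← sum_add_distrib]
        exact sum_congr rfl fun ω _ => by ring

/-- **Finite energy, a set of edges**: `(1 - p)^{|F|} Σ_{ω ⊆ S} w(ω) ≤ Σ_{ω ⊆ S ∖ F} w(ω)` for `F ⊆ S`
(`q ≥ 1`). [cite: Grimmett2006, Thm. (3.1) eq. (3.3)–(3.4)] -/
theorem pow_mul_sum_powerset_le {p q : ℝ} (hp : p ∈ Set.Icc (0 : ℝ) 1) (hq : 1 ≤ q) (B : Set V)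
    {S F : Finset (Sym2 V)} (hS : S ⊆ G.edgeFinset) (hF : F ⊆ S) :
    (1 - p) ^ #F * ∑ ω ∈ S.powerset, rcWeight G p q B ω ≤ ∑ ω ∈ (S \ F).powerset, rcWeight G p q B ω := by
  induction F using Finset.induction_on generalizing S with
  | empty => simp
  | insert f F hfF ih =>
    have hf : f ∈ S := hF (mem_insert_self f F)
    have hFS : F ⊆ S.erase f := fun x hx =>
      mem_erase.2 ⟨ne_of_mem_of_not_mem hx hfF, hF (mem_insert_of_mem hx)⟩
    rw [card_insert_of_notMem hfF, pow_succ, mul_assoc, sdiff_insert, ← erase_sdiff_comm]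
    calc (1 - p) ^ #F * ((1 - p) * ∑ ω ∈ S.powerset, rcWeight G p q B ω)
        ≤ (1 - p) ^ #F * ∑ ω ∈ (S.erase f).powerset, rcWeight G p q B ω :=
          mul_le_mul_of_nonneg_left (one_sub_mul_sum_powerset_le G hp hq B hS hf)
            (pow_nonneg (sub_nonneg.2 hp.2) _)
      _ ≤ _ := ih ((erase_subset f S).trans hS) hFS

/-- The FKG lattice condition for the random-cluster weight restricted to the edge sets of a set
`S ⊆ E(G)` of edges (extended by `0`), from the tree's `rcWeight_lattice_condition`.
[cite: Grimmett2006, Thm. 3.8 eq. (3.11)] -/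
theorem rcWeight_lattice_condition_subset {p q : ℝ} (hp : p ∈ Set.Icc (0 : ℝ) 1) (hq : 1 ≤ q)
    (B : Set V) {S : Finset (Sym2 V)} (hS : S ⊆ G.edgeFinset) (a b : Finset (Sym2 V)) :
    (if a ⊆ S then rcWeight G p q B a else 0) * (if b ⊆ S then rcWeight G p q B b else 0) ≤
      (if a ⊓ b ⊆ S then rcWeight G p q B (a ⊓ b) else 0) *
        (if a ⊔ b ⊆ S then rcWeight G p q B (a ⊔ b) else 0) := by
  have hq0 : 0 ≤ q := zero_le_one.trans hq
  have hnn : ∀ (c : Finset (Sym2 V)) (T : Finset (Sym2 V)),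
      0 ≤ (if c ⊆ T then rcWeight G p q B c else 0) := fun c T => by
    split_ifs
    · exact rcWeight_nonneg G hp hq0 B c
    · exact le_rfl
  by_cases ha : a ⊆ S
  · by_cases hb : b ⊆ S
    · have hab : a ⊓ b ⊆ S := (inter_subset_left : a ∩ b ⊆ a).trans ha
      have hab' : a ⊔ b ⊆ S := union_subset ha hb
      have key := rcWeight_lattice_condition G hp hq B a b
      rw [if_pos (ha.trans hS), if_pos (hb.trans hS), if_pos (hab.trans hS), if_pos (hab'.trans hS)] at key
      rwa [if_pos ha, if_pos hb, if_pos hab, if_pos hab']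
    · rw [if_neg hb, mul_zero]
      exact mul_nonneg (hnn _ _) (hnn _ _)
  · rw [if_neg ha, zero_mul]
    exact mul_nonneg (hnn _ _) (hnn _ _)

/-- Sums against the `0`-extended weight of `S` are sums over the edge sets of `S`. [folklore] -/
theorem sum_ite_subset_mul (S : Finset (Sym2 V)) (w F : Finset (Sym2 V) → ℝ) :
    ∑ ω, (if ω ⊆ S then w ω else 0) * F ω = ∑ ω ∈ S.powerset, w ω * F ω := by
  have hfilter : (univ : Finset (Finset (Sym2 V))).filter (· ⊆ S) = S.powerset := by
    ext ω; simp
  rw [← hfilter, sum_filter]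
  exact sum_congr rfl fun ω _ => by split_ifs <;> simp

/-- **FKG for increasing functions** under the random-cluster weights of the edge sets of `S ⊆ E(G)`
(`q ≥ 1`; Grimmett 2006, Thm. 3.8 with Thm. 2.16 — positive association for increasing random
variables): `(Σ w f)(Σ w g) ≤ (Σ w)(Σ w f g)` for `f, g ≥ 0` increasing. Mathlib's `fkg` on the lattice
of edge sets. [cite: Grimmett2006, Thm. 3.8 and Thm. 2.16] -/
theorem fkg_sum_powerset {p q : ℝ} (hp : p ∈ Set.Icc (0 : ℝ) 1) (hq : 1 ≤ q) (B : Set V)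
    {S : Finset (Sym2 V)} (hS : S ⊆ G.edgeFinset) {f g : Finset (Sym2 V) → ℝ}
    (hf0 : 0 ≤ f) (hg0 : 0 ≤ g) (hf : Monotone f) (hg : Monotone g) :
    (∑ ω ∈ S.powerset, rcWeight G p q B ω * f ω) * (∑ ω ∈ S.powerset, rcWeight G p q B ω * g ω) ≤
      (∑ ω ∈ S.powerset, rcWeight G p q B ω) *
        ∑ ω ∈ S.powerset, rcWeight G p q B ω * (f ω * g ω) := by
  have hq0 : 0 ≤ q := zero_le_one.trans hq
  have hμ0 : 0 ≤ fun ω : Finset (Sym2 V) => if ω ⊆ S then rcWeight G p q B ω else 0 := fun ω => by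
    dsimp only
    split_ifs
    · exact rcWeight_nonneg G hp hq0 B ω
    · exact le_rfl
  have key := fkg f g (fun ω => if ω ⊆ S then rcWeight G p q B ω else 0) hμ0 hf0 hg0 hf hg
    (fun a b => rcWeight_lattice_condition_subset G hp hq B hS a b)
  have e0 : ∑ ω, (if ω ⊆ S then rcWeight G p q B ω else 0) = ∑ ω ∈ S.powerset, rcWeight G p q B ω := by
    simpa using sum_ite_subset_mul S (rcWeight G p q B) fun _ => 1
  rw [sum_ite_subset_mul, sum_ite_subset_mul, sum_ite_subset_mul, e0] at key
  exact key

omit [Fintype V] in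
/-- Sums with the indicator that the edges of `T` are all closed are sums over the edge sets of
`S ∖ T`. [folklore] -/
theorem sum_powerset_ite_disjoint (S T : Finset (Sym2 V)) (F : Finset (Sym2 V) → ℝ) :
    ∑ ω ∈ S.powerset, (if Disjoint T ω then F ω else 0) = ∑ ω ∈ (S \ T).powerset, F ω := by
  rw [← sum_filter]
  refine sum_congr ?_ fun _ _ => rfl
  ext ω
  simp only [mem_filter, mem_powerset, subset_sdiff, disjoint_comm]

/-- **Decreasing cylinders are negatively correlated with increasing functions** (FKG): for the event
`D_T = {all edges of T closed}` and an increasing `X ≥ 0`,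
`(Σ_S w)(Σ_{S∖T} w X) ≤ (Σ_S w X)(Σ_{S∖T} w)`, i.e. `E(X | D_T) ≤ E(X)` for the random-cluster
measure of the edge sets of `S`. [cite: Grimmett2006, Thm. 3.8 (positive association)] -/
theorem sum_mul_sum_sdiff_le {p q : ℝ} (hp : p ∈ Set.Icc (0 : ℝ) 1) (hq : 1 ≤ q) (B : Set V)
    {S : Finset (Sym2 V)} (hS : S ⊆ G.edgeFinset) (T : Finset (Sym2 V)) {X : Finset (Sym2 V) → ℝ}
    (hX0 : 0 ≤ X) (hXm : Monotone X) :
    (∑ ω ∈ S.powerset, rcWeight G p q B ω) * (∑ ω ∈ (S \ T).powerset, rcWeight G p q B ω * X ω) ≤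
      (∑ ω ∈ S.powerset, rcWeight G p q B ω * X ω) * ∑ ω ∈ (S \ T).powerset, rcWeight G p q B ω := by
  set g : Finset (Sym2 V) → ℝ := fun ω => if Disjoint T ω then 0 else 1 with hg
  have hg0 : 0 ≤ g := fun ω => by simp only [hg, Pi.zero_apply]; split_ifs <;> norm_num
  have hgm : Monotone g := by
    intro a b hab
    simp only [hg]
    by_cases ha : Disjoint T a
    · simp only [ha, if_true]; split_ifs <;> norm_num
    · have hb : ¬ Disjoint T b := fun h => ha (h.mono_right hab)
      simp [ha, hb]
  have key := fkg_sum_powerset G hp hq B hS hX0 hg0 hXm hgm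
  -- rewrite the `g`-sums as differences
  have e1 : ∑ ω ∈ S.powerset, rcWeight G p q B ω * g ω =
      ∑ ω ∈ S.powerset, rcWeight G p q B ω - ∑ ω ∈ (S \ T).powerset, rcWeight G p q B ω := by
    rw [← sum_powerset_ite_disjoint S T, ← sum_sub_distrib]
    exact sum_congr rfl fun ω _ => by simp only [hg]; split_ifs <;> ring
  have e2 : ∑ ω ∈ S.powerset, rcWeight G p q B ω * (X ω * g ω) =
      ∑ ω ∈ S.powerset, rcWeight G p q B ω * X ω -
        ∑ ω ∈ (S \ T).powerset, rcWeight G p q B ω * X ω := by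
    rw [← sum_powerset_ite_disjoint S T, ← sum_sub_distrib]
    exact sum_congr rfl fun ω _ => by simp only [hg]; split_ifs <;> ring
  rw [e1, e2] at key
  nlinarith [key]

/-- **An edge joining two wired vertices is independent noise**: if opening `e ∈ E(G)` never changes
the wired cluster count and `X` does not depend on `e`, then
`(1 - p) Σ_{ω ⊆ E} w X = Σ_{ω ⊆ E ∖ e} w X` and `(1 - p) Σ_{ω ⊆ E} w 1_{e open} X = p Σ_{ω ⊆ E ∖ e} w X`.
[cite: Grimmett2006, Thm. (3.1) eq. (3.3) (the case `K_e`: conditional probability `p`)] -/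
theorem sum_mul_eq_of_clusterCount_insert (p q : ℝ) (B : Set V) {e : Sym2 V} (he : e ∈ G.edgeFinset)
    (hk : ∀ ω : Finset (Sym2 V), e ∉ ω →
      clusterCount (↑(insert e ω) : BondConfig V) B = clusterCount (↑ω : BondConfig V) B)
    {X : Finset (Sym2 V) → ℝ} (hX : ∀ ω : Finset (Sym2 V), e ∉ ω → X (insert e ω) = X ω) :
    (1 - p) * ∑ ω ∈ G.edgeFinset.powerset, rcWeight G p q B ω * X ω =
        ∑ ω ∈ (G.edgeFinset.erase e).powerset, rcWeight G p q B ω * X ω ∧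
      (1 - p) * ∑ ω ∈ G.edgeFinset.powerset, rcWeight G p q B ω * ((if e ∈ ω then 1 else 0) * X ω) =
        p * ∑ ω ∈ (G.edgeFinset.erase e).powerset, rcWeight G p q B ω * X ω := by
  have hnot : ∀ ω ∈ (G.edgeFinset.erase e).powerset, e ∉ ω := fun ω hω h =>
    notMem_erase e _ (mem_powerset.1 hω h)
  have hflip : ∀ ω ∈ (G.edgeFinset.erase e).powerset,
      rcWeight G p q B (insert e ω) * (1 - p) = p * rcWeight G p q B ω := fun ω hω =>
    rcWeight_insert_mul_eq G p q B he (hnot ω hω) (hk ω (hnot ω hω))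
  constructor
  · rw [sum_powerset_split_edge _ he, mul_add, mul_sum, mul_sum, ← sum_add_distrib]
    refine sum_congr rfl fun ω hω => ?_
    rw [hX ω (hnot ω hω)]
    have := hflip ω hω
    calc (1 - p) * (rcWeight G p q B ω * X ω) + (1 - p) * (rcWeight G p q B (insert e ω) * X ω)
        = ((1 - p) * rcWeight G p q B ω + rcWeight G p q B (insert e ω) * (1 - p)) * X ω := by ring
      _ = rcWeight G p q B ω * X ω := by rw [this]; ring
  · rw [sum_powerset_split_edge _ he, mul_add, mul_sum, mul_sum, mul_sum]
    have h0 : ∑ ω ∈ (G.edgeFinset.erase e).powerset,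
        (1 - p) * (rcWeight G p q B ω * ((if e ∈ ω then 1 else 0) * X ω)) = 0 :=
      sum_eq_zero fun ω hω => by rw [if_neg (hnot ω hω)]; ring
    rw [h0, zero_add]
    refine sum_congr rfl fun ω hω => ?_
    rw [if_pos (mem_insert_self e ω), hX ω (hnot ω hω), one_mul]
    have := hflip ω hω
    calc (1 - p) * (rcWeight G p q B (insert e ω) * X ω)
        = (rcWeight G p q B (insert e ω) * (1 - p)) * X ω := by ring
      _ = p * (rcWeight G p q B ω * X ω) := by rw [this]; ring

end Sums


/-! ### 3b. Bookkeeping: sums avoiding an edge, isolated vertices as indicators -/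

section Static

variable {V : Type*} [Fintype V] [DecidableEq V] (G : SimpleGraph V) [DecidableRel G.Adj]

omit [Fintype V] in
/-- Sums over the edge sets of `S` avoiding one edge `e`, as sums with the indicator of `e ∉ ω`. [folklore] -/
theorem sum_powerset_erase_eq (S : Finset (Sym2 V)) (e : Sym2 V) (F : Finset (Sym2 V) → ℝ) :
    ∑ ω ∈ (S.erase e).powerset, F ω = ∑ ω ∈ S.powerset, (if e ∈ ω then 0 else 1) * F ω := by
  rw [← sdiff_singleton_eq_erase, ← sum_powerset_ite_disjoint]
  refine sum_congr rfl fun ω _ => ?_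
  by_cases h : e ∈ ω
  · simp [h]
  · simp [h]

/-- On the edge sets of `G`, "no open edge at `x`" is "all edges of `G` at `x` are closed". [folklore] -/
theorem isolated_iff_disjoint_incidenceFinset (x : V) {ω : Finset (Sym2 V)} (hω : ω ⊆ G.edgeFinset) :
    (∀ z, z ≠ x → s(x, z) ∉ (↑ω : BondConfig V)) ↔ Disjoint (G.incidenceFinset x) ω := by
  constructor
  · intro h
    rw [Finset.disjoint_left]
    intro f hf hfω
    rw [mem_incidenceFinset] at hf
    obtain ⟨hf1, hf2⟩ := hf
    obtain ⟨z, rfl⟩ := Sym2.mem_iff_exists.1 hf2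
    have hxz : x ≠ z := G.ne_of_adj (by rw [← mem_edgeSet]; exact hf1)
    exact h z hxz.symm (mem_coe.2 hfω)
  · intro h z hz hmem
    rw [mem_coe] at hmem
    have hE : s(x, z) ∈ G.edgeFinset := hω hmem
    refine Finset.disjoint_left.1 h ?_ hmem
    rw [mem_incidenceFinset, mem_incidenceSet, ← mem_edgeSet]
    exact mem_edgeFinset.1 hE

/-- The number of isolated vertices outside `B`, as a sum of indicators over those vertices (on edge sets
of `G`). [folklore] -/
theorem natCard_isolated_eq_sum (B : Set V) {ω : Finset (Sym2 V)} (hω : ω ⊆ G.edgeFinset) :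
    (Nat.card {x : V // x ∉ B ∧ ∀ z, z ≠ x → s(x, z) ∉ (↑ω : BondConfig V)} : ℝ) =
      ∑ x ∈ univ.filter (fun x : V => x ∉ B),
        (if Disjoint (G.incidenceFinset x) ω then (1 : ℝ) else 0) := by
  have h1 : Nat.card {x : V // x ∉ B ∧ ∀ z, z ≠ x → s(x, z) ∉ (↑ω : BondConfig V)} =
      #((univ.filter fun x : V => x ∉ B).filter fun x => Disjoint (G.incidenceFinset x) ω) := by
    rw [← Nat.card_eq_finsetCard]
    refine Nat.card_congr (Equiv.subtypeEquivRight fun x => ?_)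
    rw [mem_filter, mem_filter, isolated_iff_disjoint_incidenceFinset G x hω]
    simp
  rw [h1, card_filter]
  push_cast
  rfl

end Static

end FK

end Summit.CriticalPhenomena.PercolationContinuityZ3.Theorems

end
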